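import Literature.AlgebraicGeometry.Resolution.PointBlowupAdaptedOrder
import Literature.AlgebraicGeometry.Resolution.CentreBlowupMohStability
import HarnessLib

/-!
# The adapted numbers at a coordinate centre: `ε(y)`, blow-ups of the first and second kind,
  the transversality clause (iii) — statement-level typing

`PointBlowupAdaptedOrder` types Cossart–Piltant's boundary-adapted numbers `(H, ε, ω)` of a POINT
state `(F, r)` read with a boundary `E`, and the `ω`-edge predicates of one POINT blow-up.  The walk of
the observatory (rules `bm`, `bm′`) blows up COORDINATE CENTRES `C_S = {x = 0, yᵢ = 0 (i ∈ S)}`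
(`CentreBlowup.CState / step` of `PointBlowupShadeCentres`), and the census reads at every such centre
the numbers of [Cossart–Piltant 2019, ch. 3] ("Permissible blowing ups"), case `G = 0`
(`h = Z^p + F(u)`, `i₀ = p`), in the state's own coordinates with `E` := the exceptional variables
`exc`.  This file gives those readings tree-side names, as DEFINITIONS (nothing about resolution is
asserted; the dictionary model ↔ [CP19] is the one recorded in the observatory's INVARIANTS-g21 §3 and
is repeated in each docstring):

* `CState.epsilon s = ε(x)`, `CState.omega s = ω(x)` — the point numbers of `PointBlowupAdaptedOrder`
  with `E = s.exc` (Def. 2.9–2.10, Def. 2.16);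
* `epsilonAlong S s = ε(y)` for `y` the generic point of `W = η(𝒴) = V({u_j}_{j∈J})`, `J = S`:
  "`ε(y) := m(δ(y) − Σ_{div(u_j) ⊆ E_s} d_j)`" (Def. 2.9) with "`H(y) := (∏_{div(u_j) ⊆ E_s} u_j^{H_j})`,
  `H_j := p d_j`" (Def. 2.10) and "`d_W := Σ_{j∈J_E} H_j`" (§3.1, p. 31): in the model
  `p δ(y) = ord_{C_S} F` and the components of `E` through `η(y)` are the `u_j`, `j ∈ J_E = S ∩ exc`,
  so `ε(y) = ord_{C_S} F − Σ_{j ∈ S ∩ exc} H_j`;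
* `IsHironakaPermissible p S s` — Def. 2.7: "`𝒴 ⊆ Sing_m 𝒳` and `W := η(𝒴)` has normal crossings with
  `E`": for `h = x^p + F(y)` and `𝒴 = C_S` this is `p ≤ ord_{C_S} F` (normal crossings with coordinate
  hyperplanes being automatic for a coordinate subspace);
* `IsFirstKind` — Def. 3.1: "(i) `𝒴` is Hironaka-permissible w.r.t. `E` at `x`; (ii) `ε(y) = ε(x)`";
* `HasTransverseLinear S s` — clause (iii) of Def. 3.2, "`J̄(F_{p,Z,W},E,W) := cl₀ J(F_{p,Z,W},E,W) ≠ 0`",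
  in the form Prop. 3.3 gives it: "`H⁻¹F_{p,Z} = <Σ_{j'∈J'} U_{j'}Φ_{j'}({U_j}_{j∈J}) + Ψ({U_j}_{j∈J})>`
  … with `Φ_{j'} ≠ 0` for some `j' ∈ J' ∖ (J')_E`" — in the monomial model: some monomial of `F` of least
  `S`-degree is of degree exactly one in exactly one variable `t` off `S`, and `t ∉ exc`;
* `IsSecondKind` — Def. 3.2: "(i) … Hironaka-permissible …; (ii) `ε(y) = ε(x) − 1` and `i₀(y) ≤ i₀(x)`;
  (iii) …" (`i₀(y) = i₀(x) = p` is automatic for `h = Z^p + F(u)`); `IsPermissibleCentre` = first or second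
  kind ("a permissible center `𝒴` (of the first kind or second kind)", Thm. 3.6);
* the edge predicates `EpsilonIncreases`, `OmegaIncreases / OmegaStalls / OmegaDrops` of one
  `CentreBlowup.step`, and the row-wise TEST predicates `NoOmegaIncreaseAtCentre` (Thm. 3.6:
  "`(m(x'), ω(x'), κ(x')) ≤ (m(x), ω(x), κ(x))`" read at a `p`-fold point `x'` over `x`) and
  `EpsilonIncreaseForcesFirstKindAt` (Thm. 3.6 (1): "If `ε(x') > ε(x)` … `ε(y) = ε(x) = ω(x)`").
  They are PREDICATES the atlas evaluates, never asserted;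
* `cp19Remark32` — the state of the published counterexample [CP19, Remark 3.2]
  (`h = Z^p + u₄u₁^p + u₃u₂^p`, `E = div(u₁u₂u₃)`, centre `V(Z,u₁,u₂,u₄)`), for the certificate files;
* consistency with the point file (`§4`, proved): for `S = univ` (the centre is the point),
  `epsilonAlong univ s = s.epsilon` and the point is a centre of the first kind as soon as it is
  `p`-fold ("If `y ∈ 𝒳` satisfies `m(y) = p`, it follows from the definition that `𝒴 := {y}‾` is
  permissible of the first kind at `y`", after Def. 3.1); `newExc = PointBlowup.newBoundary` and the
  centre-side `ε / ω` after a `C_univ`-step are the point-side ones (`CentreBlowup.step_univ_toState`).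

What is NOT here: CP's intrinsic `ε, ω` are read off a MINIMAL polyhedron in well adapted coordinates
and the atlas reads them in the walk's coordinates after cleaning `p`-th powers only (so agreement
counts with [CP19]'s theorems are what the census records, never violations); `κ`, condition (E), the
case `G ≠ 0`, and every claim that `ι = (m, ω, κ)` drops.  The elementary model theorem "second kind
with (iii) ⇒ neither `ε` nor `ω` increases at a point over `x`" is observatory work and lives under
`Summits/ResolutionOfSingularities/KangarooAtlas/` (staged `SecondKindOmega`), not here.
AI-assisted formalisation (observatory `pub-rosobs`, unit `pub-rosobs-carver-g24`); the quotations are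
from arXiv:1412.0868 (PDF pages), the Lean definitions are the cell's reading of them.
-/

noncomputable section

open MvPolynomial Finset

open scoped BigOperators

namespace Literature.AlgebraicGeometry.Resolution

open Literature.AlgebraicGeometry.Resolution.Hauser2010

namespace CentreBlowup

variable {σ : Type*} {K : Type*} [CommRing K]

/-! ### 1. `ε(x)`, `ω(x)` of a centre-walk state (`E = exc`) and `ε(y)` along `C_S` -/

namespace CState

/-- `ε(x) = p δ(x) − Σ_{div(u_j) ⊆ E} H_j = ord₀ F − Σ_{j ∈ exc} H_j`: the point number of
`PointBlowupAdaptedOrder` read with `E` := the exceptional variables of the state.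
[cite: CossartPiltant2019, Def. 2.9–2.10 (p. 15–16)] -/
def epsilon (s : CState σ K) : ℕ∞ :=
  PointBlowup.epsilon s.exc s.toState

/-- unfolding of `ε(x)`. [cite: CossartPiltant2019, Def. 2.9 (p. 15)] -/
theorem epsilon_eq (s : CState σ K) :
    s.epsilon = ordZero s.F - ∑ j ∈ s.exc, PointBlowup.bigH s.F j :=
  rfl

/-- `ω(x) := ε(x) − 1` if `V(F_{p,Z},E,m_S) ≠ 0` (some `∂F_{p,Z}/∂U_j ≠ 0`, `j ∉ E`), `ω(x) := ε(x)`
otherwise (case `G = 0`), with `E = exc`. [cite: CossartPiltant2019, Def. 2.16 (p. 24)] -/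
def omega (s : CState σ K) : ℕ∞ :=
  PointBlowup.omega s.exc s.toState

/-- `ω(x) = ε(x) − 1` when `V ≠ 0`. [cite: CossartPiltant2019, Def. 2.16 (p. 24)] -/
theorem omega_eq_of_vNonzero (s : CState σ K) (h : PointBlowup.VNonzero s.exc s.F) :
    s.omega = s.epsilon - 1 := by
  unfold omega PointBlowup.omega
  exact if_pos h

/-- `ω(x) = ε(x)` when `V = 0`. [cite: CossartPiltant2019, Def. 2.16 (p. 24)] -/
theorem omega_eq_of_not_vNonzero (s : CState σ K) (h : ¬ PointBlowup.VNonzero s.exc s.F) :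
    s.omega = s.epsilon := by
  unfold omega PointBlowup.omega
  exact if_neg h

/-- `ω(x) ≤ ε(x)`. [cite: CossartPiltant2019, Def. 2.16 (p. 24)] -/
theorem omega_le_epsilon (s : CState σ K) : s.omega ≤ s.epsilon :=
  PointBlowup.omega_le_epsilon _ _

/-- `ε(x) − 1 ≤ ω(x)`. [cite: CossartPiltant2019, Def. 2.16 (p. 24)] -/
theorem epsilon_sub_one_le_omega (s : CState σ K) : s.epsilon - 1 ≤ s.omega := by
  by_cases h : PointBlowup.VNonzero s.exc s.F
  · rw [omega_eq_of_vNonzero s h]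
  · rw [omega_eq_of_not_vNonzero s h]
    exact tsub_le_self

end CState

/-- `ε(y)` for `y` the generic point of `W = η(C_S) = V({u_j}_{j ∈ S})`:
"`ε(y) := m(δ(y) − Σ_{div(u_j) ⊆ E_s} d_j)`" with `H(y) := ∏_{div(u_j) ⊆ E_s} u_j^{H_j}`, `H_j = p d_j`,
and `d_W := Σ_{j ∈ J_E} H_j` — in the model `p δ(y) = ord_{C_S} F` (`ordAlong`) and the components of
`E` through `η(y)` are `{u_j = 0}`, `j ∈ J_E = S ∩ exc`: `ε(y) = ord_{C_S} F − Σ_{j ∈ S ∩ exc} H_j`.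
[cite: CossartPiltant2019, Def. 2.9–2.10 (p. 15–16) and §3.1 p. 31 (d_W)] -/
def epsilonAlong [DecidableEq σ] (S : Finset σ) (s : CState σ K) : ℕ∞ :=
  ordAlong S s.F - ∑ j ∈ S ∩ s.exc, PointBlowup.bigH s.F j

/-! ### 2. Hironaka-permissibility, first and second kind, clause (iii) -/

/-- **Hironaka-permissible w.r.t. `E`** for the coordinate centre `C_S`: "`𝒴 ⊆ Sing_m 𝒳` and
`W := η(𝒴)` has normal crossings with `E` at `s := η(x)`" — for `h = x^p + F(y)`, `C_S` (regular, and
with normal crossings with the coordinate hyperplanes of `E`) lies in the `p`-fold locus iff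
`p ≤ ord_{C_S} F`. [cite: CossartPiltant2019, Def. 2.7 (p. 14)] -/
def IsHironakaPermissible (q : ℕ) (S : Finset σ) (s : CState σ K) : Prop :=
  S.Nonempty ∧ (q : ℕ∞) ≤ ordAlong S s.F

/-- **Permissible of the first kind** at `x`: "`m(y) = m(x) = p` and (i) `𝒴` is Hironaka-permissible
w.r.t. `E` at `x`; (ii) `ε(y) = ε(x)`." [cite: CossartPiltant2019, Def. 3.1 (p. 31)] -/
def IsFirstKind [DecidableEq σ] (q : ℕ) (S : Finset σ) (s : CState σ K) : Prop :=
  IsHironakaPermissible q S s ∧ epsilonAlong S s = s.epsilon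

/-- **Clause (iii)** of Def. 3.2, "`J̄(F_{p,Z,W},E,W) := cl₀ J(F_{p,Z,W},E,W) ≠ 0`", in the shape
Prop. 3.3 gives it for a centre of the second kind: "`H⁻¹F_{p,Z} = <Σ_{j'∈J'} U_{j'}Φ_{j'}({U_j}_{j∈J})
+ Ψ({U_j}_{j∈J})>` … with `Φ_{j'} ≠ 0` for some `j' ∈ J' ∖ (J')_E`" — model reading (atlas column
`cp_iii`): some monomial `y^d` of `F` of least `S`-degree (`Σ_{i∈S} dᵢ = ord_{C_S} F`) has degree
exactly one in exactly one variable `t` off `S` (`d_t = 1`, `d_u = 0` for the other `u ∉ S`), and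
`{y_t = 0}` is not a component of `E` (`t ∉ exc`). [cite: CossartPiltant2019, Def. 3.2 (iii) and Prop. 3.3 (p. 32)] -/
def HasTransverseLinear (S : Finset σ) (s : CState σ K) : Prop :=
  ∃ d ∈ s.F.support, (degIn S d : ℕ∞) = ordAlong S s.F ∧
    ∃ t, t ∉ S ∧ t ∉ s.exc ∧ d t = 1 ∧ ∀ u, u ∉ S → u ≠ t → d u = 0

/-- **Permissible of the second kind** at `x`: "`m(y) = m(x) = p` and (i) `𝒴` is Hironaka-permissible
w.r.t. `E` at `x`; (ii) `ε(y) = ε(x) − 1` and `i₀(y) ≤ i₀(x)`; (iii) `J̄(F_{p,Z,W},E,W) ≠ 0`"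
(`i₀(y) = i₀(x) = p` for `h = Z^p + F(u)`; (ii) is written `ε(y) + 1 = ε(x)` in `ℕ∞`).
[cite: CossartPiltant2019, Def. 3.2 (p. 32)] -/
def IsSecondKind [DecidableEq σ] (q : ℕ) (S : Finset σ) (s : CState σ K) : Prop :=
  IsHironakaPermissible q S s ∧ epsilonAlong S s + 1 = s.epsilon ∧ HasTransverseLinear S s

/-- "a permissible center `𝒴` (of the first kind or second kind) at `x`".
[cite: CossartPiltant2019, Thm. 3.6 (p. 35)] -/
def IsPermissibleCentre [DecidableEq σ] (q : ℕ) (S : Finset σ) (s : CState σ K) : Prop :=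
  IsFirstKind q S s ∨ IsSecondKind q S s

/-! ### 3. Edge predicates of one `C_S`-step for `ε` and `ω` -/

/-- `ε` **increases** at the point `b` of the chart `y_j` above `C_S` (`E' = newExc`).
[cite: CossartPiltant2019, Thm. 3.6 (p. 35)] -/
def EpsilonIncreases [DecidableEq σ] [DecidableEq K] (q : ℕ) (S : Finset σ) (j : σ) (b : σ → K)
    (s : CState σ K) : Prop :=
  s.epsilon < (step q S j b s).epsilon

/-- `ω` **increases** at the point `b` of the chart `y_j` above `C_S`. [cite: CossartPiltant2019, Thm. 3.6 (p. 35)] -/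
def OmegaIncreases [DecidableEq σ] [DecidableEq K] (q : ℕ) (S : Finset σ) (j : σ) (b : σ → K)
    (s : CState σ K) : Prop :=
  s.omega < (step q S j b s).omega

/-- `ω` **stalls** (`ω(x') = ω(x)`). [cite: CossartPiltant2019, Thm. 3.6 (p. 35)] -/
def OmegaStalls [DecidableEq σ] [DecidableEq K] (q : ℕ) (S : Finset σ) (j : σ) (b : σ → K)
    (s : CState σ K) : Prop :=
  (step q S j b s).omega = s.omega

/-- `ω` **drops**. [cite: CossartPiltant2019, Thm. 3.6 (p. 35)] -/
def OmegaDrops [DecidableEq σ] [DecidableEq K] (q : ℕ) (S : Finset σ) (j : σ) (b : σ → K)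
    (s : CState σ K) : Prop :=
  (step q S j b s).omega < s.omega

/-- [CP19, Thm. 3.6] READ AT ONE `C_S`-STEP: "Let `π : 𝒳' → 𝒳` be the blowing up along a permissible
center `𝒴` (of the first kind or second kind) at `x`, `x' ∈ π⁻¹(x)` … Then
`(m(x'), ω(x'), κ(x')) ≤ (m(x), ω(x), κ(x))`" — at a point of the fibre over the origin (`j ∈ S`,
`b_j = 0`, `bᵢ = 0` off `S`) which is again `p`-fold, `ω` does not increase.  Hypotheses of the printed
theorem not modelled: well adapted coordinates on both sides, `ω(x) > 0` finite, condition (E).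
A predicate the atlas tests; not asserted. [cite: CossartPiltant2019, Thm. 3.6 (p. 35)] -/
def NoOmegaIncreaseAtCentre [DecidableEq σ] [DecidableEq K] (p : ℕ) (S : Finset σ) (j : σ)
    (b : σ → K) (s : CState σ K) : Prop :=
  j ∈ S → b j = 0 → (∀ i, i ∉ S → b i = 0) → IsPermissibleCentre p S s →
    IsEquimultiplePoint p S j b s → 0 < s.omega → s.omega ≠ ⊤ → ¬ OmegaIncreases p S j b s

/-- [CP19, Thm. 3.6 (1)] READ AT ONE `C_S`-STEP: "If `ε(x') > ε(x)`, the following holds: (1) we have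
`i₀(m_S) = p`, `ε(y) = ε(x) = ω(x)` …" — an increase of `ε` at a `p`-fold point over `x` forces the
centre to be of the first kind and `ω(x) = ε(x)`.  A predicate the atlas tests; not asserted.
[cite: CossartPiltant2019, Thm. 3.6 (1) (p. 35)] -/
def EpsilonIncreaseForcesFirstKindAt [DecidableEq σ] [DecidableEq K] (p : ℕ) (S : Finset σ) (j : σ)
    (b : σ → K) (s : CState σ K) : Prop :=
  j ∈ S → b j = 0 → (∀ i, i ∉ S → b i = 0) → IsPermissibleCentre p S s →
    IsEquimultiplePoint p S j b s → 0 < s.omega → s.omega ≠ ⊤ → EpsilonIncreases p S j b s →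
    epsilonAlong S s = s.epsilon ∧ s.omega = s.epsilon

/-! ### 4. The published counterexample without (iii) -/

/-- [CP19, Remark 3.2]: "A counterexample with `n = 4` is given for `char S = p > 0` by taking:
`h = Z^p + u₄u₁^p + u₃u₂^p`, `E = div(u₁u₂u₃)` … `𝒴₁ = V(Z,u₁,u₂,u₄)` … we have
`ε(y₀) = ε(y₁) = ε(x) − 1 = ω(x) = p`. Note that `𝒴₁` does not satisfy definition 3.2 (iii). …
`h' = Z'^p + u'₄u'₁^p + u₃u'₂^p`, `E' = div(u'₁u'₂u₃u'₄)`. Thus `ε(x') = ω(x') = p + 1 > ω(x)`."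
The state (variables `0,1,2,3` for `u₁,…,u₄`, `r = 0`). [cite: CossartPiltant2019, Remark 3.2 (p. 41)] -/
def cp19Remark32 (p : ℕ) : CState (Fin 4) K where
  F := X 3 * X 0 ^ p + X 2 * X 1 ^ p
  r := 0
  exc := {0, 1, 2}

/-- The larger centre `𝒴₁ = V(Z,u₁,u₂,u₄)` of Remark 3.2: `S₁ = {u₁,u₂,u₄}`. [cite: CossartPiltant2019, Remark 3.2 (p. 41)] -/
def cp19Remark32Centre : Finset (Fin 4) := {0, 1, 3}

/-- The permissible curve `𝒴₀ = V(Z,u₁,u₂)` of Remark 3.2 (second kind): `S₀ = {u₁,u₂}`. [cite: CossartPiltant2019, Remark 3.2 (p. 41)] -/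
def cp19Remark32Curve : Finset (Fin 4) := {0, 1}

/-! ### 5. Consistency with the point file (`S = univ`) -/

section Univ

variable [DecidableEq σ] [DecidableEq K]

/-- The new set of exceptional components of a `C_S`-step is the boundary transport of
`PointBlowupAdaptedOrder` applied to `E = exc`. [cite: CossartPiltant2019, Prop. 2.13 (E' := σ⁻¹(E)_red)] -/
theorem newExc_eq_newBoundary (j : σ) (b : σ → K) (s : CState σ K) :
    newExc j b s = PointBlowup.newBoundary j b s.exc := by
  ext i
  simp only [newExc, PointBlowup.newBoundary, mem_insert, mem_filter]
  constructor
  · rintro (h | ⟨hi, hb⟩)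
    · exact Or.inl h
    · by_cases hij : i = j
      · exact Or.inl hij
      · exact Or.inr ⟨hi, hij, hb⟩
  · rintro (h | ⟨hi, -, hb⟩)
    · exact Or.inl h
    · exact Or.inr ⟨hi, hb⟩

variable [Fintype σ]

section FieldK

variable {L : Type*} [Field L] [DecidableEq L]

omit [DecidableEq L] in
/-- For the point (`S = univ`) `ε(y) = ε(x)` ("`𝒴 := {y}‾` is permissible of the first kind at `y`").
[cite: CossartPiltant2019, Def. 3.1 (p. 31)] -/
theorem epsilonAlong_univ (s : CState σ L) : epsilonAlong Finset.univ s = s.epsilon := by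
  classical
  unfold epsilonAlong
  rw [ordAlong_univ, Finset.univ_inter]
  rfl

omit [DecidableEq L] in
/-- "If `y ∈ 𝒳` satisfies `m(y) = p`, it follows from the definition that `𝒴 := {y}‾` is permissible of
the first kind at `y`": in the model, the point itself (`S = univ`) is a centre of the first kind as
soon as it is `p`-fold. [cite: CossartPiltant2019, Def. 3.1 (p. 31)] -/
theorem isFirstKind_univ [Nonempty σ] (q : ℕ) (s : CState σ L) (hq : (q : ℕ∞) ≤ ordZero s.F) :
    IsFirstKind q Finset.univ s := by
  classical
  refine ⟨⟨Finset.univ_nonempty, ?_⟩, epsilonAlong_univ s⟩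
  rw [ordAlong_univ]
  exact hq

/-- After a `C_univ`-step the centre-side `ε` is the point-side `ε` with the transported boundary.
[cite: CossartPiltant2019, Def. 2.9 (p. 15)] -/
theorem epsilon_step_univ (q : ℕ) (j : σ) (b : σ → L) (s : CState σ L) :
    (step q Finset.univ j b s).epsilon =
      PointBlowup.epsilon (PointBlowup.newBoundary j b s.exc) (PointBlowup.step q j b s.toState) := by
  classical
  unfold CState.epsilon
  rw [step_univ_toState, ← newExc_eq_newBoundary]
  rfl

/-- After a `C_univ`-step the centre-side `ω` is the point-side `ω` with the transported boundary.
[cite: CossartPiltant2019, Def. 2.16 (p. 24)] -/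
theorem omega_step_univ (q : ℕ) (j : σ) (b : σ → L) (s : CState σ L) :
    (step q Finset.univ j b s).omega =
      PointBlowup.omega (PointBlowup.newBoundary j b s.exc) (PointBlowup.step q j b s.toState) := by
  classical
  unfold CState.omega
  rw [step_univ_toState, ← newExc_eq_newBoundary]
  rfl

/-- The centre-side `ω`-increase predicate at `S = univ` is the point-side one of
`PointBlowupAdaptedOrder`. [cite: CossartPiltant2019, Thm. 3.6 (p. 35)] -/
theorem omegaIncreases_univ_iff (q : ℕ) (j : σ) (b : σ → L) (s : CState σ L) :
    OmegaIncreases q Finset.univ j b s ↔ PointBlowup.OmegaIncreases q j b s.exc s.toState := by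
  classical
  unfold OmegaIncreases PointBlowup.OmegaIncreases
  rw [omega_step_univ]
  rfl

end FieldK

end Univ

end CentreBlowup

end Literature.AlgebraicGeometry.Resolution

end
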